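import Mathlib.RingTheory.RegularLocalRing.Defs
import Mathlib.RingTheory.Ideal.Cotangent
import Mathlib.LinearAlgebra.Dimension.Finite
import Mathlib.Algebra.Ring.Aut
import HarnessLib

/-!
# Eigen-parameters of a tame cyclic automorphism of a regular local ring

Topic: `Literature/AlgebraicGeometry/Resolution`. PROOF side of `CossartPiltant2019ReductionP`
(`ArithmeticalThreefoldsLocal.lean`), second brick (after `TameCyclicInvariants.lean`) of its one
remaining input (C4) — descent of local uniformization below the ramification field ([CoP1]
Prop. 9.3/9.5 with Lemma 9.4). In the proof of [CoP1] Lemma 9.4 (HAL p. 29, journal §9) the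
action of the cyclic group `G = ⟨g⟩` of prime order `l ≠ p` on the `G`-stable local
uniformization `S` is first DIAGONALISED on a regular system of parameters: "the action on
`Ŝ ≃ κ(S)[[x₁, x₂, x₃]]` is given by `g.xᵢ = ζ_l^{tᵢ} xᵢ` … Note that it can be assumed that
`x₁, x₂, x₃ ∈ S` by (29), since `k(ζ_l) ⊂ S`", where (29)–(30) (proof of Prop. 6.2 (2), journal
p. 19) is the twisted Reynolds average `yⱼ := |H|⁻¹ ∑_h χⱼ(h⁻¹) h.xⱼ`, "`h.yⱼ = χⱼ(h) yⱼ` … i.e.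
the action is diagonal". This file proves the underlying statement of commutative algebra,
without completions and without residue-field hypotheses:

* `exists_eigen_regularParameters_of_tameCyclic` — PROVED: for a regular local ring `B` of
  dimension `d`, a ring automorphism `σ` of `B` with `σ^ℓ = 1`, `ℓ ∈ Bˣ`, and `ζ ∈ B` fixed by
  `σ` with `ζ^ℓ = 1` and `ζ^k − 1 ∈ Bˣ` for `0 < k < ℓ`, there is a regular system of parameters
  `x₁, …, x_d` of `B` (`d` generators of `𝔪_B`) consisting of EIGENVECTORS of `σ`:
  `σ xⱼ = ζ^{tⱼ} xⱼ` with `tⱼ < ℓ`. (Twisted Reynolds operators `P_k = ∑ᵢ ζ^{−ki} σⁱ`: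
  `σ ∘ P_k = ζ^k P_k`, `∑_k P_k = ℓ · id` and `P_k(𝔪_B) ⊆ 𝔪_B`, so `𝔪_B` is generated by
  eigenvectors; a subset whose classes form a basis of `𝔪_B/𝔪_B²` is a regular system of
  parameters by Nakayama.)

Everything is PROVED; no named facts are introduced.

## Sources

* V. Cossart, O. Piltant, *Resolution of singularities of threefolds in positive characteristic.
  I*, J. Algebra 320 (2008) 1051–1082: proof of Prop. 6.2 (2), (28)–(30), and proof of Lemma 9.4
  (HAL hal-00139124, pp. 18–19 and 28–29). [CossartPiltant2008]
-/

noncomputable section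

open IsLocalRing

namespace Literature.AlgebraicGeometry.Resolution

universe u

/-! ## Diagonalising a tame cyclic automorphism on a regular system of parameters -/

section Eigenparameters

variable {B : Type u} [CommRing B]

/-- **A tame cyclic automorphism of a regular local ring admits a regular system of parameters
of eigenvectors** ([CoP1] proof of Prop. 6.2 (2), (29)–(30): "`yⱼ := |H|⁻¹ ∑_{h ∈ H} χⱼ(h⁻¹)(h.xⱼ)`
… `h.yⱼ = χⱼ(h) yⱼ` … i.e. the action is diagonal", journal p. 19; used in the proof of Lemma 9.4,
p. 29: "it can be assumed that `x₁, x₂, x₃ ∈ S` by (29), since `k(ζ_l) ⊂ S`"; proved here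
algebraically, without completion). Data: a regular local ring `B` of Krull dimension `d`, a ring
automorphism `σ` of `B` with `σ^ℓ = 1` (`ℓ ≠ 0`), `ℓ` a unit of `B`, and `ζ ∈ B` with `σ ζ = ζ`,
`ζ^ℓ = 1` and `ζ^k − 1` a unit for `0 < k < ℓ`. Then `𝔪_B` is generated by `d` elements
`x₁, …, x_d` with `σ xⱼ = ζ^{tⱼ} xⱼ`, `tⱼ < ℓ`. Proof: the twisted Reynolds operators
`P_k b = ∑_{i<ℓ} ζ^{−ki} σⁱ b` satisfy `σ (P_k b) = ζ^k P_k b`, `∑_{k<ℓ} P_k b = ℓ b` and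
`P_k(𝔪_B) ⊆ 𝔪_B`; hence `𝔪_B` is generated by eigenvectors, and among them `d` whose classes form
a basis of `𝔪_B/𝔪_B²` generate `𝔪_B` (Nakayama).
[cite: CossartPiltant2008, proof of Prop. 6.2 (2), (29)–(30) (journal p. 19) and proof of Lemma 9.4 (HAL p. 29)] -/
theorem exists_eigen_regularParameters_of_tameCyclic [IsRegularLocalRing B]
    (σ : B ≃+* B) {ℓ : ℕ} (hℓ0 : ℓ ≠ 0) (hσℓ : σ ^ ℓ = 1) (hℓu : IsUnit ((ℓ : B)))
    (ζ : B) (hσζ : σ ζ = ζ) (hζℓ : ζ ^ ℓ = 1)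
    (hζu : ∀ k : ℕ, 0 < k → k < ℓ → IsUnit (ζ ^ k - 1))
    {d : ℕ} (hdim : ringKrullDim B = (d : ℕ)) :
    ∃ (x : Fin d → B) (t : Fin d → ℕ), Ideal.span (Set.range x) = maximalIdeal B ∧
      ∀ j, t j < ℓ ∧ σ (x j) = ζ ^ (t j) * x j := by
  classical
  have hℓpos : 0 < ℓ := Nat.pos_of_ne_zero hℓ0
  -- `ζ' = ζ⁻¹`
  set ζ' : B := ζ ^ (ℓ - 1) with hζ'def
  have hζζ' : ζ * ζ' = 1 := by
    rw [hζ'def, ← pow_succ', Nat.sub_add_cancel hℓpos, hζℓ]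
  have hζ'ζ : ζ' * ζ = 1 := by rw [mul_comm, hζζ']
  have hζ'ℓ : ζ' ^ ℓ = 1 := by rw [hζ'def, ← pow_mul, mul_comm, pow_mul, hζℓ, one_pow]
  have hσζ' : σ ζ' = ζ' := by rw [hζ'def, map_pow, hσζ]
  have hσiζ : ∀ (i n : ℕ), (σ ^ i) (ζ ^ n) = ζ ^ n := by
    intro i n
    induction i with
    | zero => rfl
    | succ i ih => rw [pow_succ', RingAut.mul_apply, ih, map_pow, hσζ]
  have hσiζ' : ∀ (i n : ℕ), (σ ^ i) (ζ' ^ n) = ζ' ^ n := by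
    intro i n
    rw [hζ'def, ← pow_mul, hσiζ]
  have hσℓb : ∀ b : B, (σ ^ ℓ) b = b := fun b => by rw [hσℓ]; rfl
  -- `σⁱ` preserves the maximal ideal
  have hσm : ∀ (i : ℕ) (b : B), b ∈ maximalIdeal B → (σ ^ i) b ∈ maximalIdeal B := by
    intro i b hb
    rw [IsLocalRing.mem_maximalIdeal, mem_nonunits_iff] at hb ⊢
    intro hu
    apply hb
    have := hu.map (σ ^ i).symm
    rwa [RingEquiv.symm_apply_apply] at this
  /- the twisted Reynolds operators -/
  let P : ℕ → B → B := fun k b => ∑ i ∈ Finset.range ℓ, ζ' ^ (k * i) * (σ ^ i) b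
  have hPdef : ∀ k b, P k b = ∑ i ∈ Finset.range ℓ, ζ' ^ (k * i) * (σ ^ i) b := fun _ _ => rfl
  -- `σ ∘ P_k = ζ^k P_k`
  have hσP : ∀ k b, σ (P k b) = ζ ^ k * P k b := by
    intro k b
    rw [hPdef, map_sum, Finset.mul_sum]
    -- `f i := ζ^k ζ'^{ki} σⁱ b`; LHS = ∑_{i<ℓ} f (i+1), RHS = ∑_{i<ℓ} f i, and `f ℓ = f 0`
    let f : ℕ → B := fun i => (ζ ^ k * ζ' ^ (k * i)) * (σ ^ i) b
    have hf : ∀ i, σ (ζ' ^ (k * i) * (σ ^ i) b) = f (i + 1) := by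
      intro i
      rw [map_mul, map_pow, hσζ', show σ ((σ ^ i) b) = (σ ^ (i + 1)) b by
        rw [pow_succ', RingAut.mul_apply]]
      change _ = (ζ ^ k * ζ' ^ (k * (i + 1))) * (σ ^ (i + 1)) b
      congr 1
      rw [mul_add, mul_one, pow_add, ← mul_assoc, mul_comm (ζ ^ k), mul_assoc, ← mul_pow, hζζ',
        one_pow, mul_one]
    have hg : ∀ i, ζ ^ k * (ζ' ^ (k * i) * (σ ^ i) b) = f i := by
      intro i
      change _ = (ζ ^ k * ζ' ^ (k * i)) * (σ ^ i) b
      rw [mul_assoc]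
    simp only [hf, hg]
    have hfℓ : f ℓ = f 0 := by
      change (ζ ^ k * ζ' ^ (k * ℓ)) * (σ ^ ℓ) b = (ζ ^ k * ζ' ^ (k * 0)) * (σ ^ 0) b
      rw [mul_comm k ℓ, pow_mul, hζ'ℓ, one_pow, mul_zero, pow_zero, hσℓb, pow_zero,
        RingAut.one_apply]
    obtain ⟨m, hm⟩ : ∃ m, ℓ = m + 1 := ⟨ℓ - 1, by omega⟩
    rw [hm, Finset.sum_range_succ' f, Finset.sum_range_succ (fun x => f (x + 1)), ← hm, hfℓ]
  -- the character sums
  have hchar : ∀ k, 0 < k → k < ℓ → (∑ i ∈ Finset.range ℓ, ζ' ^ (k * i)) = 0 := by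
    intro k hk hkℓ
    have h1 : (∑ i ∈ Finset.range ℓ, (ζ' ^ k) ^ i) * (ζ' ^ k - 1) = 0 := by
      rw [geom_sum_mul, ← pow_mul, mul_comm, pow_mul, hζ'ℓ, one_pow, sub_self]
    -- `ζ'^k − 1 = −ζ'^k (ζ^k − 1)` is a unit
    have hu : IsUnit (ζ' ^ k - 1) := by
      have h2 : ζ' ^ k - 1 = -(ζ' ^ k * (ζ ^ k - 1)) := by
        rw [mul_sub, mul_one, ← mul_pow, hζ'ζ, one_pow]; ring
      rw [h2]
      exact ((IsUnit.of_mul_eq_one ζ hζ'ζ).pow k |>.mul (hζu k hk hkℓ)).neg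
    have h3 : (∑ i ∈ Finset.range ℓ, (ζ' ^ k) ^ i) = 0 :=
      (hu.mul_left_eq_zero).mp h1
    rw [← h3]
    exact Finset.sum_congr rfl fun i _ => by rw [pow_mul]
  -- `∑_k P_k = ℓ · id`
  have hsumP : ∀ b, (∑ k ∈ Finset.range ℓ, P k b) = (ℓ : B) * b := by
    intro b
    simp only [hPdef]
    rw [Finset.sum_comm]
    -- `∑_i (∑_k ζ'^{ki}) σⁱ b`: the term `i = 0` is `ℓ b`, the others vanish
    have h1 : ∀ i ∈ Finset.range ℓ,
        (∑ k ∈ Finset.range ℓ, ζ' ^ (k * i) * (σ ^ i) b) =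
          (∑ k ∈ Finset.range ℓ, ζ' ^ (i * k)) * (σ ^ i) b := by
      intro i _
      rw [Finset.sum_mul]
      exact Finset.sum_congr rfl fun k _ => by rw [mul_comm k i]
    rw [Finset.sum_congr rfl h1]
    obtain ⟨m, hm⟩ : ∃ m, ℓ = m + 1 := ⟨ℓ - 1, by omega⟩
    rw [hm, Finset.sum_range_succ' (fun i => (∑ k ∈ Finset.range (m + 1), ζ' ^ (i * k)) * (σ ^ i) b),
      ← hm]
    have h2 : ∀ i ∈ Finset.range m,
        (∑ k ∈ Finset.range ℓ, ζ' ^ ((i + 1) * k)) * (σ ^ (i + 1)) b = 0 := by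
      intro i hi
      rw [hchar (i + 1) (Nat.succ_pos i) (by rw [hm]; exact Nat.succ_lt_succ (Finset.mem_range.mp hi)),
        zero_mul]
    rw [Finset.sum_eq_zero h2, zero_add]
    simp
  -- `P_k(𝔪_B) ⊆ 𝔪_B`
  have hPm : ∀ k b, b ∈ maximalIdeal B → P k b ∈ maximalIdeal B := by
    intro k b hb
    rw [hPdef]
    exact Ideal.sum_mem _ fun i _ => Ideal.mul_mem_left _ _ (hσm i b hb)
  /- `𝔪_B` is generated by eigenvectors -/
  obtain ⟨u, hu⟩ := hℓu.exists_left_inv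
  let E : Set (maximalIdeal B) := {e | ∃ k, k < ℓ ∧ σ (e : B) = ζ ^ k * (e : B)}
  have hEspan : Submodule.span B E = ⊤ := by
    rw [eq_top_iff]
    rintro y -
    -- `y = ∑_k u • P_k y`
    have hy : y = ∑ k ∈ Finset.range ℓ, u • (⟨P k y, hPm k y y.2⟩ : maximalIdeal B) := by
      apply Subtype.ext
      rw [AddSubmonoidClass.coe_finsetSum]
      simp only [SetLike.val_smul, smul_eq_mul]
      rw [← Finset.mul_sum, hsumP, ← mul_assoc, hu, one_mul]
    rw [hy]
    refine Submodule.sum_mem _ fun k hk => Submodule.smul_mem _ _ (Submodule.subset_span ?_)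
    exact ⟨k, Finset.mem_range.mp hk, hσP k y⟩
  /- extract a regular system of parameters -/
  set κ := ResidueField B with hκ
  set V := CotangentSpace B with hV
  have hspanκ : Submodule.span κ ((maximalIdeal B).toCotangent '' E) = ⊤ :=
    IsLocalRing.CotangentSpace.span_image_eq_top_iff.mpr hEspan
  -- the spanning family of classes of eigenvectors
  let w : E → V := fun e => (maximalIdeal B).toCotangent (e : maximalIdeal B)
  have hwrange : Set.range w = (maximalIdeal B).toCotangent '' E := by
    ext v
    constructor
    · rintro ⟨e, rfl⟩; exact ⟨e, e.2, rfl⟩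
    · rintro ⟨e, he, rfl⟩; exact ⟨⟨e, he⟩, rfl⟩
  obtain ⟨ι, a, -, hspan_eq, hli⟩ := exists_linearIndependent' (K := κ) w
  have hspanι : Submodule.span κ (Set.range (w ∘ a)) = ⊤ := by
    rw [hspan_eq, hwrange, hspanκ]
  haveI : Finite ι := hli.finite
  letI : Fintype ι := Fintype.ofFinite ι
  let bas : Module.Basis ι κ V := Module.Basis.mk hli (le_of_eq hspanι.symm)
  -- `card ι = d`
  have hfinrank : Module.finrank κ V = d := by
    have h1 := (IsRegularLocalRing.iff_finrank_cotangentSpace B).mp inferInstance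
    rw [hdim] at h1
    exact_mod_cast h1
  have hcard : Fintype.card ι = d := by
    rw [← hfinrank, Module.finrank_eq_card_basis bas]
  let eqv : ι ≃ Fin d := Fintype.equivFinOfCardEq hcard
  -- the parameters
  let e : Fin d → maximalIdeal B := fun j => ((a (eqv.symm j)) : maximalIdeal B)
  have heE : ∀ j, (e j) ∈ E := fun j => (a (eqv.symm j)).2
  have hespan : Submodule.span B (Set.range e) = ⊤ := by
    apply IsLocalRing.CotangentSpace.span_image_eq_top_iff.mp
    rw [← Set.range_comp]
    have h1 : (maximalIdeal B).toCotangent ∘ e = (w ∘ a) ∘ eqv.symm := by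
      ext j; rfl
    rw [h1, Set.range_comp, eqv.symm.range_eq_univ, Set.image_univ, hspanι]
  choose t ht using heE
  refine ⟨fun j => (e j : B), t, ?_, fun j => ⟨(ht j).1, (ht j).2⟩⟩
  -- `Ideal.span (range x) = 𝔪_B`
  have h1 : Set.range (fun j => (e j : B)) = (maximalIdeal B).subtype '' Set.range e := by
    rw [← Set.range_comp]; rfl
  rw [h1]
  change Submodule.span B _ = _
  rw [← Submodule.map_span, hespan, Submodule.map_top, Submodule.range_subtype]

end Eigenparameters

end Literature.AlgebraicGeometry.Resolution

end
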